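import Summits.HodgeConjecture.HodgeConjecture.Theses.GaloisSieve

/-!
# Birth skeleton (BC3) of the crux `SporadicAlgebraicity` (stmt-HodgeConjecture-14562),
# route `GaloisSieve` — line `birth`: "sieve ⇒ finite primitive census ⇒ inflate"

The crux (rank 3 of the route, card K4, REPAIRED CUT 2026-08-16):

  for every `p ≥ 2`, every level `m ≥ 1` and every INDECOMPOSABLE (`¬ IsDecomposable`) ISOLATED
  (`¬ OnHodgeLine`) Hodge character `α : Fin (2p+2) → ℤ/m`, the eigenline `V(α) ⊂ H²ᵖ(X²ᵖₘ(ℂ); ℂ)`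
  of the Fermat `2p`-fold of degree `m` (spelled inline as the simultaneous eigenvectors of the
  diagonal symmetries `g_a`, `a ∈ μₘ²ᵖ⁺²`) consists of algebraic classes.

The route's own two-layer plan for this node (route header, TWO-LAYER PLAN: `SporadicAlgebraicity ⇐
EffectiveSieveBound(p) → FiniteCensusCycles → SporadicAlgebraicity`) is typed here as THREE stubs and
a kernel-checked composition:

* STUB 1 `stub_isolatedOrderBound` (the SIEVE, indecomposable form; open for `p ≥ 2`, Aoki–Shioda's
  Theorem (𝔅²ₘ) with bound `180` at `p = 1`): for every `p ≥ 2` the indecomposable isolated Hodge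
  characters of length `2p+2`, of all levels, have BOUNDED additive order — they are finitely many
  torsion points of the character torus. This is the route item `SieveFiniteness` WEAKENED to the
  indecomposable characters and to `p ≥ 2` (all the composition needs; the route header lists this
  weakening under NOT DECOMPOSED YET), and `stubSieve_of_sieveFiniteness` PROVES that the route item
  implies it, so one proof closes both.
* STUB 2 `stub_primitiveCensus` (the FINITE SPORADIC LIST; open, first entry da Silva's
  `(1,4,16,22,25,31)/33`, arXiv:2101.04739 Prop. 3.6 / Question 1): for `p ≥ 2`, every PRIMITIVE
  (`addOrderOf α = m`, i.e. `gcd(a₀,…,a_{2p+1},m) = 1`) indecomposable isolated Hodge character of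
  level `m ≤ isolatedOrderBound p` — the OPTIMAL sieve constant, `sInf` of the admissible bounds,
  so that given STUB 1 this is literally a finite list of torsion points per `p`, and WITHOUT STUB 1
  (`isolatedOrderBound p = 0`) it is vacuous and gives nothing — has an algebraic eigenline. Each
  entry wants its own cycle (Newton-identity complete intersections, K3 correspondences, Villaflor
  periods, or reachability from Aoki's supply lattice: see the crux idea
  `sporadic-list-mod-supply-lattice` filed as evidence on the item, which cuts the `p = 2` list to
  three residual orbits below level `160`).
* STUB 3 `stub_levelInflation` (KNOWN — Shioda–Katsura 1979 §1 / Shioda 1979 §1 / Aoki–Shioda 1983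
  §2 "`f^* V(α') = V(α)`": the level map `f : X_{mN} → Xₘ`, `(xᵢ) ↦ (xᵢᴺ)` (tree:
  `fermatLevelMap`, `hypersurfacePoint_map_fermatLevelMap`) is the quotient by
  `K = ker(μ_{mN}²ᵖ⁺² → μₘ²ᵖ⁺²)`, so `H²ᵖ(X_{mN})^K = f^* H²ᵖ(Xₘ)` (transfer) and, `f` intertwining
  `g_a` on `X_{mN}` with `g_{aᴺ}` on `Xₘ`, `V(N·α') = f^* V(α')`; pull-backs of algebraic classes are
  algebraic): algebraicity of `V(α')` at level `m` implies algebraicity of `V(N·α')` at level `mN`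
  (`FermatCharacter.inflate N`, tree). Size M–L on the tree's carriers (the transfer for the finite
  quotient `f` is not yet in the tree, `FermatLevelMap` module docstring).

COMPOSITION `SporadicAlgebraicity_of` (REAL proof, no `sorry`): given an indecomposable isolated
Hodge `α` of level `m` and order `d ∣ m`, `m = dN`, DESCEND `α = N·α'` to a primitive character `α'`
of level `d` (`exists_eq_inflate`; PROVED here: `α'` is again Hodge — units of `ℤ/dN` surject onto
those of `ℤ/d` —, indecomposable — a splitting of `α'` inflates to one of `α` —, isolated —
`OnHodgeLine.inflate` of the tree — and primitive — inflation is an injective additive map, so it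
preserves orders); STUB 1 bounds `d = addOrderOf α ≤ isolatedOrderBound p` (the optimal constant is
admissible, `Nat.sInf_mem`); STUB 2 makes `V(α')` algebraic; STUB 3 inflates back to `V(α)`.
All three stubs are load-bearing.

## Contents

* `EigenlineAlgebraic p m α` — "`V(α) ⊆ algebraicClasses`", the crux's inline eigenline clause
  VERBATIM (`sporadicAlgebraicity_iff` is `Iff.rfl`).
* `isolatedOrderBound p` — the optimal sieve constant (`sInf`; `0` if the sieve fails at `p`).
* the three stubs (the ONLY `sorry`s), `SporadicAlgebraicity_of` (stub₁ → stub₂ → stub₃ → the crux BY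
  NAME), `SporadicAlgebraicity_of_stubs`.
* PROVED descent arithmetic: `level_nsmul_eq_zero`, `addOrderOf_dvd_level`, `exists_eq_inflate`,
  `isHodge_of_inflate`, `isDecomposable_map_inflate`, `nsmul_eq_zero_iff_forall`, `addOrderOf_inflate`;
  and `stubSieve_of_sieveFiniteness` (route item `SieveFiniteness` ⇒ STUB 1).

Disproof used: none on file (`Cruxes/SporadicAlgebraicity/` had no `Disproof.lean` and no landed
`Negative/` lemma at registration, 2026-08-17; `ledger negatives --problem HodgeConjecture` bears on
no stub). Dead lines: none recorded for this crux.
-/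

noncomputable section

namespace Summit.HodgeConjecture.HodgeConjecture.Cruxes.SporadicAlgebraicity.Birth

open Finset
open Literature.AlgebraicGeometry.Motives Literature.AlgebraicGeometry.HodgeTheory
  Literature.AlgebraicTopology.SingularHomology
open Summit.HodgeConjecture.HodgeConjecture.Theses.GaloisSieve (SporadicAlgebraicity SieveFiniteness)

/-! ### The eigenline clause and the optimal sieve constant -/

/-- **`V(α) ⊆ algebraicClasses`** for a character `α : Fin (2p+2) → ℤ/m` of the Fermat `2p`-fold of
degree `m`: every class `c ∈ H²ᵖ(X²ᵖₘ(ℂ); ℂ)` which is a simultaneous eigenvector of the diagonal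
symmetries `g_a`, `a ∈ μₘ²ᵖ⁺²`, with eigencharacter `∏ aᵢ^⟨αᵢ⟩`, is algebraic — the crux's inline
clause verbatim (`= fermatEigenspace m α (2p) ≤ algebraicClasses _ p` by the bridge
`mem_fermatEigenspace_iff`, planner evidence Delta.lean on the item). [cite: Shioda1979HodgeFermat, §1] -/
def EigenlineAlgebraic (p m : ℕ) (α : Fin (2 * p + 2) → ZMod m) : Prop :=
  ∀ c : complexBetti (SmoothHypersurface.hypersurface (fermatPolynomial ℂ (2 * p) m)) (2 * p),
    (∀ (a : Fin (2 * p + 2) → ℂˣ) (ha : a ∈ diagonalStabilizer (fermatPolynomial ℂ (2 * p) m)),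
      (∀ i, a i ^ m = 1) →
        singularCohomology.map ℂ ℂ (diagonalMap (fermatPolynomial ℂ (2 * p) m) ha) (2 * p) c =
          (∏ i, ((a i : ℂˣ) : ℂ) ^ (α i).val) • c) →
    c ∈ algebraicClasses (SmoothHypersurface.hypersurface (fermatPolynomial ℂ (2 * p) m)) p

/-- The crux, read through `EigenlineAlgebraic` (`Iff.rfl`: the clause is verbatim). [folklore] -/
theorem sporadicAlgebraicity_iff :
    SporadicAlgebraicity ↔
      ∀ (p m : ℕ) [NeZero m] (α : Fin (2 * p + 2) → ZMod m), 2 ≤ p → FermatCharacter.IsHodge α →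
        ¬ FermatCharacter.IsDecomposable (univ.val.map α) → ¬ FermatCharacter.OnHodgeLine α →
          EigenlineAlgebraic p m α :=
  Iff.rfl

/-- **The optimal sieve constant** `M₀(p)`: the least `M` bounding the additive order (= the exact
level `m / gcd(a₀, …, a_{2p+1}, m)`) of every indecomposable isolated Hodge character of length
`2p+2`, over all levels; `0` if there is no such bound (the sieve fails at `p`). Aoki–Shioda:
`M₀(1) = 180`; refuter censuses on the item: `M₀(2) ≥ 240`. [cite: AokiShioda1983, §2 Theorem (𝔅²ₘ) ("exceptional elements exist only for m ≤ 180")] -/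
def isolatedOrderBound (p : ℕ) : ℕ :=
  sInf {M : ℕ | ∀ (m : ℕ) [NeZero m] (α : Fin (2 * p + 2) → ZMod m), FermatCharacter.IsHodge α →
    ¬ FermatCharacter.IsDecomposable (univ.val.map α) → ¬ FermatCharacter.OnHodgeLine α →
      addOrderOf α ≤ M}

/-! ### The three registered stubs -/

/-- STUB 1 (THE SIEVE, indecomposable form; open for `p ≥ 2`) — **isolated indecomposable Hodge
characters of each length have bounded order.** For every `p ≥ 2` there is `M₀` such that every
indecomposable Hodge character `α` of length `2p+2`, of any level `m`, lying on no Hodge line has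
`addOrderOf α ≤ M₀` in `(ℤ/m)²ᵖ⁺²`: the isolated characters are finitely many torsion points of the
character torus `{θ ∈ (ℝ/ℤ)²ᵖ⁺² | Σθᵢ = 0}`. Mechanism (card P1): a Hodge character is a torsion point
whose whole Galois orbit `(ℤ/m)ˣ·α` lies in the open slab `{Σ{θᵢ} = p+1}`; Weyl's criterion with
Ramanujan-sum bounds for the orbit forces a point of large order to be nearly annihilated by a
frequency of bounded size, and recursion inside the finitely many Galois-stable codimension-one
torsion cosets ends in cosets on which the slab is dense (Hodge lines) or in points. Known cases:
depth 1 (`m` prime ⇒ paired ⇒ on a line, tree `IsIsolated.eq_zero_of_prime`); `p = 1` with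
`M₀ = 180` (Theorem (𝔅²ₘ)). The route item `SieveFiniteness` implies this stub
(`stubSieve_of_sieveFiniteness` below). Why it might fail: the recursion is unwritten beyond length
`4`; the `p = 2` certified-isolated counts peak at `60:416`, `120:351` (refuter censuses to
`m = 240`) and an infinite isolated indecomposable family of one length kills it (route kill
criterion (i)). [cite: AokiShioda1983, §2 Theorem (𝔅²ₘ)] [cite: BombieriGubler2001, §4.3]
[cite: KuipersNiederreiter1974, Ch. 2 §2 (Erdős–Turán–Koksma)] -/
theorem stub_isolatedOrderBound :
    ∀ p : ℕ, 2 ≤ p → ∃ M₀ : ℕ, ∀ (m : ℕ) [NeZero m] (α : Fin (2 * p + 2) → ZMod m),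
      FermatCharacter.IsHodge α → ¬ FermatCharacter.IsDecomposable (univ.val.map α) →
        ¬ FermatCharacter.OnHodgeLine α → addOrderOf α ≤ M₀ := by
  sorry

/-- STUB 2 (THE FINITE SPORADIC CENSUS; open) — **every primitive indecomposable isolated Hodge
character of level at most the sieve constant has an algebraic eigenline.** For `p ≥ 2`,
`m ≤ isolatedOrderBound p` and `α : Fin (2p+2) → ℤ/m` PRIMITIVE (`addOrderOf α = m`: the values
and `m` are coprime, Aoki–Shioda's `GCD = 1` normalisation), Hodge, indecomposable and isolated,
`V(α)` is algebraic. Given STUB 1 this is a FINITE list of torsion points per `p` (for `p = 2`: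
certified-isolated primitive orbits start `14:1 18:3 20:5 21:2 24:20 28:5 30:75 33:1 36:31 …`, of
which all but `33:1, 36:5, 45:1, 48:5` below `48` are Shioda quasi- or semi-decomposable, refuter
evidence EVIDENCE.md / REVIEW.md on the item; modulo Aoki's supply lattice three residual orbits
below `160`, crux idea `sporadic-list-mod-supply-lattice`); each entry wants an individual cycle —
first open entry da Silva's `(1,4,16,22,25,31)/33` (Hodge, pair-free hence indecomposable,
certified isolated; outside `P₃₃` and Aoki's standard cycles). Without STUB 1 the hypothesis
`m ≤ isolatedOrderBound p = 0` is unsatisfiable and the stub says nothing. Why it might fail: it is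
an instance family of the Hodge conjecture; one non-algebraic entry (da Silva's Question 1) kills
the route and the summit. [cite: daSilva2021HodgeFermat, Prop. 3.6 and Question 1]
[cite: Aoki1987, Thm. 1-4 and Cor. 2-3] [cite: AljovinMovasatiVillaflor2019, §1] -/
theorem stub_primitiveCensus :
    ∀ (p m : ℕ) [NeZero m] (α : Fin (2 * p + 2) → ZMod m), 2 ≤ p → m ≤ isolatedOrderBound p →
      addOrderOf α = m → FermatCharacter.IsHodge α →
        ¬ FermatCharacter.IsDecomposable (univ.val.map α) → ¬ FermatCharacter.OnHodgeLine α →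
          EigenlineAlgebraic p m α := by
  sorry

/-- STUB 3 (LEVEL INFLATION OF ALGEBRAICITY; known in print, M–L in the tree) — **`f^* V(α') =
V(N·α')` and pull-backs of algebraic classes are algebraic.** If every class of the eigenline `V(α')`
of the Fermat `2p`-fold of degree `m` is algebraic, then so is every class of the eigenline
`V(N·α')` (`FermatCharacter.inflate N`, `⟨N·a⟩ = N⟨a⟩`) of the Fermat `2p`-fold of degree `mN`,
`N ≥ 1`. Proof in print: the level map `f : X_{mN} → Xₘ`, `(xᵢ) ↦ (xᵢᴺ)` (tree: `fermatLevelMap`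
at level `N * m`, `hypersurfacePoint_map_fermatLevelMap`; transport `N * m = m * N`) is the quotient
by the finite group `K = ker(μ_{mN}²ᵖ⁺² → μₘ²ᵖ⁺²)`, so `f^* : H²ᵖ(Xₘ(ℂ); ℂ) ⥲ H²ᵖ(X_{mN}(ℂ); ℂ)^K`
(transfer for finite quotients, rational coefficients); `f ∘ g_a = g_{aᴺ} ∘ f`, so `f^*` carries
`V(β)` into `V(N·β)` for every `β`, the `V(N·β)` are distinct for distinct `β`, and `V(N·α') ⊆ H^K`
(the character `∏ aᵢ^{N a'ᵢ}` is trivial on `K`) — hence `V(N·α') = f^* V(α')`; finally `f^*`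
preserves algebraic classes (tree: `AlgebraicClassesPullback`). Why it might fail: only through the
missing transfer `H^*(X_{mN})^K = f^* H^*(Xₘ)` on the tree's carriers (not yet landed,
`FermatLevelMap` docstring); the statement is Shioda's. [cite: ShiodaKatsura1979, §1]
[cite: Shioda1979HodgeFermat, §1] [cite: AokiShioda1983, §2 (GCD-reduction, "f^*V(α') = V(α)")] -/
theorem stub_levelInflation :
    ∀ (p m N : ℕ) [NeZero m], 0 < N → ∀ α : Fin (2 * p + 2) → ZMod m,
      EigenlineAlgebraic p m α →
        EigenlineAlgebraic p (m * N) (fun i ↦ FermatCharacter.inflate N (α i)) := by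
  sorry

/-! ### Proved descent arithmetic (no `sorry` below this line) -/

section Descent

variable {m r : ℕ}

/-- Every character of `μₘʳ` is killed by the level: `m • α = 0`. [folklore] -/
theorem level_nsmul_eq_zero (α : Fin r → ZMod m) : m • α = 0 := by
  funext i
  show m • α i = 0
  rw [nsmul_eq_mul, ZMod.natCast_self, zero_mul]

/-- The additive order of a character divides the level. [folklore] -/
theorem addOrderOf_dvd_level (α : Fin r → ZMod m) : addOrderOf α ∣ m :=
  addOrderOf_dvd_of_nsmul_eq_zero (level_nsmul_eq_zero α)

/-- `n • β = 0` coordinatewise. [folklore] -/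
theorem nsmul_eq_zero_iff_forall {k : ℕ} (β : Fin r → ZMod k) (n : ℕ) :
    n • β = 0 ↔ ∀ i, n • β i = 0 :=
  ⟨fun h i ↦ congrFun h i, fun h ↦ funext fun i ↦ h i⟩

/-- **Descent of characters killed by `m` from level `mN` to level `m`** (Aoki–Shioda's
GCD-reduction `α = dα'`): if `m • α = 0` in `(ℤ/mN)ʳ` then every `⟨αᵢ⟩` is a multiple of `N` and
`α = N·α'` for the character `α'ᵢ = ⟨αᵢ⟩/N` of level `m`. [cite: AokiShioda1983, §2 (GCD-reduction)] -/
theorem exists_eq_inflate [NeZero m] {N : ℕ} (hN : 0 < N) (α : Fin r → ZMod (m * N))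
    (h : m • α = 0) : ∃ α' : Fin r → ZMod m, α = fun i ↦ FermatCharacter.inflate N (α' i) := by
  haveI : NeZero (m * N) := ⟨Nat.mul_ne_zero (NeZero.ne m) hN.ne'⟩
  have hdiv : ∀ i, N ∣ (α i).val := by
    intro i
    have hi : (m : ZMod (m * N)) * α i = 0 := by
      have := (nsmul_eq_zero_iff_forall α m).mp h i
      rwa [nsmul_eq_mul] at this
    rw [← ZMod.natCast_zmod_val (α i), ← Nat.cast_mul, ZMod.natCast_eq_zero_iff] at hi
    -- hi : m * N ∣ m * (α i).val
    exact Nat.dvd_of_mul_dvd_mul_left (Nat.pos_of_ne_zero (NeZero.ne m)) hi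
  refine ⟨fun i ↦ (((α i).val / N : ℕ) : ZMod m), funext fun i ↦ ?_⟩
  have hlt : (α i).val / N < m := by
    have hv : (α i).val < N * m := (ZMod.val_lt (α i)).trans_eq (Nat.mul_comm m N)
    exact Nat.div_lt_of_lt_mul hv
  rw [FermatCharacter.inflate_def, ZMod.val_natCast, Nat.mod_eq_of_lt hlt,
    Nat.mul_div_cancel' (hdiv i), ZMod.natCast_zmod_val]

/-- **Descent of the Hodge condition**: if `N·α` is a Hodge character of level `mN` then `α` is a
Hodge character of level `m` (`⟨N a⟩ = N⟨a⟩`, and every unit of `ℤ/m` lifts to a unit of `ℤ/mN`).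
Converse of the tree's `IsHodge.inflate`. [cite: AokiShioda1983, §2 ("α' is an element of 𝔅²_{m'}")] -/
theorem isHodge_of_inflate [NeZero m] {N : ℕ} (hN : 0 < N) {α : Fin r → ZMod m}
    (h : FermatCharacter.IsHodge fun i ↦ FermatCharacter.inflate N (α i)) :
    FermatCharacter.IsHodge α := by
  haveI : NeZero (m * N) := ⟨Nat.mul_ne_zero (NeZero.ne m) hN.ne'⟩
  obtain ⟨⟨hne, hsum⟩, hunits⟩ := h
  refine ⟨⟨fun i h0 ↦ hne i ((FermatCharacter.inflate_eq_zero_iff hN (α i)).mpr h0), ?_⟩,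
    fun t ↦ ?_⟩
  · -- `∑ αᵢ = 0`: `∑ N⟨αᵢ⟩ ≡ 0 (mod mN)` gives `m ∣ ∑ ⟨αᵢ⟩`
    have hs : (∑ i, FermatCharacter.inflate N (α i)) =
        ((N * FermatCharacter.normSum α : ℕ) : ZMod (m * N)) := by
      simp only [FermatCharacter.inflate_def, FermatCharacter.normSum, Finset.mul_sum, Nat.cast_sum]
    have hsum' : ((N * FermatCharacter.normSum α : ℕ) : ZMod (m * N)) = 0 := by
      rw [← hs]; exact hsum
    rw [ZMod.natCast_eq_zero_iff, Nat.mul_comm m N] at hsum'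
    have hdvd : m ∣ FermatCharacter.normSum α := Nat.dvd_of_mul_dvd_mul_left hN hsum'
    rw [← FermatCharacter.natCast_normSum, ZMod.natCast_eq_zero_iff]
    exact hdvd
  · -- units: lift `t ∈ (ℤ/m)ˣ` to `s ∈ (ℤ/mN)ˣ`; `s · (N·α) = N·(t α)` and `|N·β| = N|β|`
    obtain ⟨s, rfl⟩ := ZMod.unitsMap_surjective (dvd_mul_right m N) t
    have h2 := hunits s
    simp only [FermatCharacter.normSum, FermatCharacter.unit_mul_inflate hN,
      FermatCharacter.val_inflate hN, ← Finset.mul_sum] at h2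
    -- h2 : 2 * (N * ∑ i, (↑(unitsMap _ s) * α i).val) = m * N * r
    unfold FermatCharacter.normSum
    apply Nat.eq_of_mul_eq_mul_left hN
    calc N * (2 * ∑ i, ((ZMod.unitsMap (dvd_mul_right m N) s : ZMod m) * α i).val)
        = 2 * (N * ∑ i, ((ZMod.unitsMap (dvd_mul_right m N) s : ZMod m) * α i).val) := by ring
      _ = m * N * r := h2
      _ = N * (m * r) := by ring

/-- **Inflation preserves decomposability**: a splitting `{α'} = ξ' + ξ''` into non-empty Hodge
multisets inflates to the splitting `{N·α'} = N·ξ' + N·ξ''` (tree: `IsHodgeMultiset.map_inflate`).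
[cite: Shioda1979PJA, §1 Definition (i)] -/
theorem isDecomposable_map_inflate [NeZero m] {N : ℕ} (hN : 0 < N) {α : Fin r → ZMod m}
    (h : FermatCharacter.IsDecomposable (univ.val.map α)) :
    FermatCharacter.IsDecomposable (univ.val.map fun i ↦ FermatCharacter.inflate N (α i)) := by
  obtain ⟨t, u, ht, hu, hHt, hHu, htu⟩ := h
  have hmap : univ.val.map (fun i ↦ FermatCharacter.inflate N (α i)) =
      (univ.val.map α).map (FermatCharacter.inflate N) := by
    rw [Multiset.map_map]
    rfl
  refine ⟨t.map (FermatCharacter.inflate N), u.map (FermatCharacter.inflate N), ?_, ?_,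
    hHt.map_inflate hN, hHu.map_inflate hN, ?_⟩
  · simpa using ht
  · simpa using hu
  · rw [hmap, htu, Multiset.map_add]

/-- **Inflation preserves the additive order** (`a ↦ N·a : ℤ/m → ℤ/mN` is an injective additive
map: `n · (N·a) = N·(n a)` and `N·a = 0 ↔ a = 0`), so a primitive `α'` of level `m` inflates to a
character of order exactly `m`. [folklore] -/
theorem addOrderOf_inflate [NeZero m] {N : ℕ} (hN : 0 < N) (α : Fin r → ZMod m) :
    addOrderOf (fun i ↦ FermatCharacter.inflate N (α i)) = addOrderOf α := by
  rw [addOrderOf_eq_addOrderOf_iff]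
  intro n
  rw [nsmul_eq_zero_iff_forall, nsmul_eq_zero_iff_forall]
  show (∀ i, n • FermatCharacter.inflate N (α i) = 0) ↔ ∀ i, n • α i = 0
  refine forall_congr' fun i ↦ ?_
  rw [nsmul_eq_mul, nsmul_eq_mul, FermatCharacter.natCast_mul_inflate,
    FermatCharacter.inflate_eq_zero_iff hN]

end Descent

/-- **The route item `SieveFiniteness` implies STUB 1** (its `¬ ∃ v, …` clause is `¬ OnHodgeLine α`
by `Iff.rfl`, tree `onHodgeLine_iff`; drop the indecomposability hypothesis and `p ≥ 2 ⇒ p > 0`).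
[folklore] -/
theorem stubSieve_of_sieveFiniteness (h : SieveFiniteness) :
    ∀ p : ℕ, 2 ≤ p → ∃ M₀ : ℕ, ∀ (m : ℕ) [NeZero m] (α : Fin (2 * p + 2) → ZMod m),
      FermatCharacter.IsHodge α → ¬ FermatCharacter.IsDecomposable (univ.val.map α) →
        ¬ FermatCharacter.OnHodgeLine α → addOrderOf α ≤ M₀ := by
  intro p hp
  obtain ⟨M₀, hM⟩ := h p (by omega)
  exact ⟨M₀, fun m _ α hH _ hL ↦ hM m α hH hL⟩

/-! ### The composition: stub₁ → stub₂ → stub₃ → the crux, by name -/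

/-- **THE LINE'S COMPOSITION** (kernel-checked, no `sorry`): the sieve (STUB 1), the finite
primitive census (STUB 2) and level inflation (STUB 3) imply `SporadicAlgebraicity`. Given an
indecomposable isolated Hodge `α` of level `m` and order `d`, write `m = dN` and DESCEND `α = N·α'`
to a primitive `α'` of level `d` — again Hodge, indecomposable, isolated (proved descent lemmas and
the tree's `OnHodgeLine.inflate`); STUB 1 gives `d ≤ isolatedOrderBound p` (the optimal constant is
admissible, `Nat.sInf_mem`), STUB 2 makes `V(α')` algebraic, STUB 3 inflates to `V(α)`. [folklore] -/
theorem SporadicAlgebraicity_of :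
    (∀ p : ℕ, 2 ≤ p → ∃ M₀ : ℕ, ∀ (m : ℕ) [NeZero m] (α : Fin (2 * p + 2) → ZMod m),
      FermatCharacter.IsHodge α → ¬ FermatCharacter.IsDecomposable (univ.val.map α) →
        ¬ FermatCharacter.OnHodgeLine α → addOrderOf α ≤ M₀) →
    (∀ (p m : ℕ) [NeZero m] (α : Fin (2 * p + 2) → ZMod m), 2 ≤ p → m ≤ isolatedOrderBound p →
      addOrderOf α = m → FermatCharacter.IsHodge α →
        ¬ FermatCharacter.IsDecomposable (univ.val.map α) → ¬ FermatCharacter.OnHodgeLine α →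
          EigenlineAlgebraic p m α) →
    (∀ (p m N : ℕ) [NeZero m], 0 < N → ∀ α : Fin (2 * p + 2) → ZMod m,
      EigenlineAlgebraic p m α →
        EigenlineAlgebraic p (m * N) (fun i ↦ FermatCharacter.inflate N (α i))) →
    Summit.HodgeConjecture.HodgeConjecture.Theses.GaloisSieve.SporadicAlgebraicity := by
  intro hS hC hI p m _ α hp hH hD hL
  -- the order `d` of `α` divides the level: `m = d * N`
  obtain ⟨N, hN⟩ := addOrderOf_dvd_level α
  have hd0 : 0 < addOrderOf α := by
    rcases Nat.eq_zero_or_pos (addOrderOf α) with h0 | h0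
    · exact absurd hN (by rw [h0, zero_mul]; exact NeZero.ne m)
    · exact h0
  generalize hd : addOrderOf α = d at hN hd0
  subst hN
  haveI : NeZero d := ⟨hd0.ne'⟩
  have hN0 : 0 < N := Nat.pos_of_ne_zero fun h0 ↦ NeZero.ne (d * N) (by rw [h0, mul_zero])
  -- descend `α = N·α'` to a primitive character `α'` of level `d`
  obtain ⟨α', rfl⟩ := exists_eq_inflate hN0 α
    (by have h1 := addOrderOf_nsmul_eq_zero α; rwa [hd] at h1)
  have hH' : FermatCharacter.IsHodge α' := isHodge_of_inflate hN0 hH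
  have hD' : ¬ FermatCharacter.IsDecomposable (univ.val.map α') :=
    fun h ↦ hD (isDecomposable_map_inflate hN0 h)
  have hL' : ¬ FermatCharacter.OnHodgeLine α' := fun h ↦ hL (h.inflate hN0)
  have hprim : addOrderOf α' = d := (addOrderOf_inflate hN0 α').symm.trans hd
  -- the sieve: `d ≤ M₀(p)`, the optimal constant being admissible
  have hne : Set.Nonempty {M : ℕ | ∀ (m : ℕ) [NeZero m] (α : Fin (2 * p + 2) → ZMod m),
      FermatCharacter.IsHodge α → ¬ FermatCharacter.IsDecomposable (univ.val.map α) →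
        ¬ FermatCharacter.OnHodgeLine α → addOrderOf α ≤ M} := by
    obtain ⟨M₀, hM₀⟩ := hS p hp
    exact ⟨M₀, hM₀⟩
  have hmem := Nat.sInf_mem hne
  have hB : d ≤ isolatedOrderBound p := by
    have h1 : addOrderOf (fun i ↦ FermatCharacter.inflate N (α' i)) ≤ isolatedOrderBound p :=
      hmem (d * N) (fun i ↦ FermatCharacter.inflate N (α' i)) hH hD hL
    rwa [hd] at h1
  -- the census at level `d`, inflated back to level `d * N`
  exact hI p d N hN0 α' (hC p d α' hp hB hprim hH' hD' hL')

/-- **The crux, closed modulo exactly the three registered stubs.** -/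
theorem SporadicAlgebraicity_of_stubs :
    Summit.HodgeConjecture.HodgeConjecture.Theses.GaloisSieve.SporadicAlgebraicity :=
  SporadicAlgebraicity_of stub_isolatedOrderBound stub_primitiveCensus stub_levelInflation

end Summit.HodgeConjecture.HodgeConjecture.Cruxes.SporadicAlgebraicity.Birth

end
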